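import Mathlib.RepresentationTheory.Semisimple
import Mathlib.RepresentationTheory.Basic
import Mathlib.RingTheory.SimpleModule.Basic
import Mathlib.RingTheory.Artinian.Module
import Mathlib.LinearAlgebra.DFinsupp
import Mathlib.LinearAlgebra.Finsupp.Span
import Mathlib.Tactic.Group
import HarnessLib

/-!
# Clifford's theorem: restriction to a normal subgroup preserves semisimplicity

Topic `Literature/RepresentationTheory/Semisimple`.  Everything in this file is PROVED (no
definition beyond three auxiliary submodule constructions, no named fact).

Let `k` be a field, `G` a group, `N ◁ G` a normal subgroup and `ρ : G → GL(V)` a representation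
on a finite-dimensional `k`-vector space.  **Clifford's theorem** (A. H. Clifford, *Representations
induced in an invariant subgroup*, Ann. of Math. 38 (1937), Thm. 1; Curtis–Reiner, *Representation
Theory of Finite Groups and Associative Algebras* (1962), (49.2)): if `ρ` is semisimple
(completely reducible), so is its restriction `ρ|_N`.  Proof (Clifford): for an irreducible `ρ`,
pick an irreducible `k[N]`-submodule `W ⊆ V`; its conjugates `ρ(g) W`, `g ∈ G`, are again
irreducible `k[N]`-submodules (`N` is normal), and their sum is a non-zero `G`-stable subspace,
hence all of `V`; so `V|_N` is a sum of irreducibles.  A semisimple `ρ` is a sum of irreducible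
subrepresentations, and a sum of semisimple `k[N]`-submodules is semisimple.

Main result: `Literature.RepresentationTheory.Semisimple.Representation.isSemisimpleRepresentation_restrictSubgroup`
(Mathlib's `Representation.IsSemisimpleRepresentation`, i.e. every subrepresentation has a
complement; via `isSemisimpleRepresentation_iff_isSemisimpleModule_asModule` and the `k[G]`- and
`k[N]`-module structures `Representation.asModule`).  The file was written by the tenured seat of
`Literature.NumberTheory.Automorphic.HarrisLanTaylorThorne2016.theoremA_existence`
(Harris–Lan–Taylor–Thorne 2016, Thm. A = Cor. 7.14): in the patching argument of its printed
proof (Harris–Taylor, Thm. VII.1.9, pp. 229–231; Chenevier–Harris, Camb. J. Math. 1 (2013),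
§3.1: "`ρ_i|_{Γ_{E_iE_j}} ≃ ρ_j|_{Γ_{E_iE_j}}`" for *semisimple* `ρ_i`) the restrictions of the
semisimple `r_{p,ı}(BC(π))` to the absolute Galois groups of composite fields — normal subgroups
of finite index — must be semisimple for the Chebotarev–Brauer–Nesbitt uniqueness
(`FramedGaloisRep.nonempty_equiv_of_hasFrobCharpolyAt_eventually`) to apply.

## References

* A. H. Clifford, *Representations induced in an invariant subgroup*, Ann. of Math. (2) 38
  (1937), 533–550, Thm. 1. [Clifford1937]
* C. W. Curtis, I. Reiner, *Representation Theory of Finite Groups and Associative Algebras*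
  (1962), §49, (49.2). [CurtisReiner1962]
-/

noncomputable section

open MonoidAlgebra

namespace Literature.RepresentationTheory.Semisimple

namespace Representation

variable {k G V : Type*} [Field k] [Group G] [AddCommGroup V] [Module k V]
  (ρ : _root_.Representation k G V) (N : Subgroup G)

/-- The restriction `ρ|_N = ρ ∘ (N ↪ G)` of a representation to a subgroup, as a
`Representation k N V` (Mathlib `MonoidHom.comp`; the abbreviation only pins the type, so that
`Representation.asModule` and `Representation.IsSemisimpleRepresentation` apply). [folklore] -/
abbrev restrictSubgroup : _root_.Representation k N V := ρ.comp N.subtype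

/-- Unfolding lemma for `restrictSubgroup`. [folklore] -/
@[simp] theorem restrictSubgroup_apply (n : N) : restrictSubgroup ρ N n = ρ (n : G) := rfl

/-! ### Transport of submodules between `k[G]`, `k[N]` and conjugates -/

/-- A `k[G]`-submodule of `V` (for the module structure `ρ.asModule`) viewed as a
`k[N]`-submodule of `V` (for the module structure of the restriction `ρ|_N`): same carrier.
[folklore] -/
def resSubmodule (S : Submodule (MonoidAlgebra k G) ρ.asModule) :
    Submodule (MonoidAlgebra k N) (restrictSubgroup ρ N).asModule where
  carrier := {x | ρ.asModuleEquiv.symm ((restrictSubgroup ρ N).asModuleEquiv x) ∈ S}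
  zero_mem' := by simp
  add_mem' {x y} hx hy := by
    simp only [Set.mem_setOf_eq, map_add] at hx hy ⊢
    exact S.add_mem hx hy
  smul_mem' a {x} hx := by
    simp only [Set.mem_setOf_eq] at hx ⊢
    rw [_root_.Representation.asModuleEquiv_map_smul]
    induction a using MonoidAlgebra.induction_on with
    | hM n =>
      rw [MonoidAlgebra.of_apply, _root_.Representation.asAlgebraHom_single_one,
        restrictSubgroup_apply, _root_.Representation.asModuleEquiv_symm_map_rho]
      exact S.smul_mem _ hx
    | hadd a b ha hb =>
      rw [map_add, LinearMap.add_apply, map_add]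
      exact S.add_mem ha hb
    | hsmul r a ha =>
      rw [map_smul, LinearMap.smul_apply, _root_.Representation.asModuleEquiv_symm_map_smul]
      exact S.smul_mem _ ha

/-- Membership in `resSubmodule`. [folklore] -/
@[simp] theorem mem_resSubmodule {S : Submodule (MonoidAlgebra k G) ρ.asModule}
    {x : (restrictSubgroup ρ N).asModule} :
    x ∈ resSubmodule ρ N S ↔ ρ.asModuleEquiv.symm ((restrictSubgroup ρ N).asModuleEquiv x) ∈ S :=
  Iff.rfl

/-- A `k[N]`-submodule `T` of `V|_N` whose carrier is stable under all `ρ(g)`, `g ∈ G`, viewed as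
a `k[G]`-submodule of `V` (same carrier). [folklore] -/
def indSubmodule (T : Submodule (MonoidAlgebra k N) (restrictSubgroup ρ N).asModule)
    (hT : ∀ g : G, ∀ x : (restrictSubgroup ρ N).asModule, x ∈ T →
      (restrictSubgroup ρ N).asModuleEquiv.symm (ρ g ((restrictSubgroup ρ N).asModuleEquiv x)) ∈ T) :
    Submodule (MonoidAlgebra k G) ρ.asModule where
  carrier := {y | (restrictSubgroup ρ N).asModuleEquiv.symm (ρ.asModuleEquiv y) ∈ T}
  zero_mem' := by simp
  add_mem' {x y} hx hy := by
    simp only [Set.mem_setOf_eq, map_add] at hx hy ⊢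
    exact T.add_mem hx hy
  smul_mem' a {y} hy := by
    simp only [Set.mem_setOf_eq] at hy ⊢
    rw [_root_.Representation.asModuleEquiv_map_smul]
    induction a using MonoidAlgebra.induction_on with
    | hM g =>
      rw [MonoidAlgebra.of_apply, _root_.Representation.asAlgebraHom_single_one]
      have h := hT g _ hy
      simpa using h
    | hadd a b ha hb =>
      rw [map_add, LinearMap.add_apply, map_add]
      exact T.add_mem ha hb
    | hsmul r a ha =>
      rw [map_smul, LinearMap.smul_apply, _root_.Representation.asModuleEquiv_symm_map_smul]
      exact T.smul_mem _ ha

/-- Membership in `indSubmodule`. [folklore] -/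
@[simp] theorem mem_indSubmodule {T : Submodule (MonoidAlgebra k N) (restrictSubgroup ρ N).asModule}
    {hT} {y : ρ.asModule} :
    y ∈ indSubmodule ρ N T hT ↔ (restrictSubgroup ρ N).asModuleEquiv.symm (ρ.asModuleEquiv y) ∈ T :=
  Iff.rfl

variable [N.Normal]

/-- The **conjugate** `ρ(g) T` of a `k[N]`-submodule `T` of `V|_N` by `g ∈ G`, defined as the
preimage of `T` under `ρ(g⁻¹)`; it is a `k[N]`-submodule because `N` is normal
(`ρ(g⁻¹) ρ(n) = ρ(g⁻¹ n g) ρ(g⁻¹)`). [folklore] -/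
def conjSubmodule (g : G) (T : Submodule (MonoidAlgebra k N) (restrictSubgroup ρ N).asModule) :
    Submodule (MonoidAlgebra k N) (restrictSubgroup ρ N).asModule where
  carrier := {x | (restrictSubgroup ρ N).asModuleEquiv.symm
    (ρ g⁻¹ ((restrictSubgroup ρ N).asModuleEquiv x)) ∈ T}
  zero_mem' := by simp
  add_mem' {x y} hx hy := by
    simp only [Set.mem_setOf_eq, map_add] at hx hy ⊢
    exact T.add_mem hx hy
  smul_mem' a {x} hx := by
    simp only [Set.mem_setOf_eq] at hx ⊢
    rw [_root_.Representation.asModuleEquiv_map_smul]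
    induction a using MonoidAlgebra.induction_on with
    | hM n =>
      rw [MonoidAlgebra.of_apply, _root_.Representation.asAlgebraHom_single_one,
        restrictSubgroup_apply]
      -- `ρ(g⁻¹) ρ(n) = ρ(g⁻¹ n g) ρ(g⁻¹)` with `g⁻¹ n g ∈ N`
      have hn : g⁻¹ * (n : G) * g ∈ N := by
        have h := (inferInstance : N.Normal).conj_mem (n : G) n.2 g⁻¹
        rwa [inv_inv] at h
      have hcomm : ρ g⁻¹ (ρ (n : G) ((restrictSubgroup ρ N).asModuleEquiv x)) =
          (restrictSubgroup ρ N) ⟨g⁻¹ * n * g, hn⟩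
            (ρ g⁻¹ ((restrictSubgroup ρ N).asModuleEquiv x)) := by
        rw [restrictSubgroup_apply, ← Module.End.mul_apply, ← map_mul,
          ← Module.End.mul_apply, ← map_mul]
        congr 2
        group
      rw [hcomm, _root_.Representation.asModuleEquiv_symm_map_rho]
      exact T.smul_mem _ hx
    | hadd a b ha hb =>
      rw [map_add, LinearMap.add_apply, map_add, map_add]
      exact T.add_mem ha hb
    | hsmul r a ha =>
      rw [map_smul, LinearMap.smul_apply, map_smul,
        _root_.Representation.asModuleEquiv_symm_map_smul]
      exact T.smul_mem _ ha

/-- Membership in a conjugate. [folklore] -/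
@[simp] theorem mem_conjSubmodule {g : G}
    {T : Submodule (MonoidAlgebra k N) (restrictSubgroup ρ N).asModule}
    {x : (restrictSubgroup ρ N).asModule} :
    x ∈ conjSubmodule ρ N g T ↔ (restrictSubgroup ρ N).asModuleEquiv.symm
      (ρ g⁻¹ ((restrictSubgroup ρ N).asModuleEquiv x)) ∈ T :=
  Iff.rfl

/-- `ρ(1) T = T`. [folklore] -/
theorem conjSubmodule_one (T : Submodule (MonoidAlgebra k N) (restrictSubgroup ρ N).asModule) :
    conjSubmodule ρ N 1 T = T := by
  ext x
  simp

/-- `ρ(g) (ρ(h) T) = ρ(g h) T`. [folklore] -/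
theorem conjSubmodule_mul (g h : G)
    (T : Submodule (MonoidAlgebra k N) (restrictSubgroup ρ N).asModule) :
    conjSubmodule ρ N g (conjSubmodule ρ N h T) = conjSubmodule ρ N (g * h) T := by
  ext x
  simp only [mem_conjSubmodule, LinearEquiv.apply_symm_apply, mul_inv_rev, map_mul,
    Module.End.mul_apply]

/-- Conjugation is monotone. [folklore] -/
theorem conjSubmodule_mono (g : G)
    {T T' : Submodule (MonoidAlgebra k N) (restrictSubgroup ρ N).asModule} (h : T ≤ T') :
    conjSubmodule ρ N g T ≤ conjSubmodule ρ N g T' :=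
  fun _ hx ↦ h hx

/-- Conjugation by `g` is an automorphism of the lattice of `k[N]`-submodules of `V|_N`
(inverse: conjugation by `g⁻¹`). [folklore] -/
def conjOrderIso (g : G) :
    Submodule (MonoidAlgebra k N) (restrictSubgroup ρ N).asModule ≃o
      Submodule (MonoidAlgebra k N) (restrictSubgroup ρ N).asModule where
  toFun := conjSubmodule ρ N g
  invFun := conjSubmodule ρ N g⁻¹
  left_inv T := by rw [conjSubmodule_mul, inv_mul_cancel, conjSubmodule_one]
  right_inv T := by rw [conjSubmodule_mul, mul_inv_cancel, conjSubmodule_one]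
  map_rel_iff' {T T'} := by
    change conjSubmodule ρ N g T ≤ conjSubmodule ρ N g T' ↔ T ≤ T'
    refine ⟨fun h ↦ ?_, conjSubmodule_mono ρ N g⟩
    have h' := conjSubmodule_mono ρ N g⁻¹ h
    rwa [conjSubmodule_mul, conjSubmodule_mul, inv_mul_cancel, conjSubmodule_one,
      conjSubmodule_one] at h'

/-- Unfolding lemma for `conjOrderIso`. [folklore] -/
@[simp] theorem conjOrderIso_apply (g : G)
    (T : Submodule (MonoidAlgebra k N) (restrictSubgroup ρ N).asModule) :
    conjOrderIso ρ N g T = conjSubmodule ρ N g T := rfl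

/-- Conjugates of atoms (irreducible `k[N]`-submodules) are atoms. [folklore] -/
theorem isAtom_conjSubmodule {g : G}
    {W : Submodule (MonoidAlgebra k N) (restrictSubgroup ρ N).asModule} (hW : IsAtom W) :
    IsAtom (conjSubmodule ρ N g W) := by
  rw [← conjOrderIso_apply, OrderIso.isAtom_iff]
  exact hW

/-! ### Clifford's theorem -/

variable [FiniteDimensional k V]

/-- **Clifford's theorem, irreducible case.**  For a normal subgroup `N ◁ G` and an irreducible
`k[G]`-submodule `S` of the finite-dimensional representation `V`, the `k[N]`-module `S|_N` is
semisimple: it is the sum of the conjugates `ρ(g) W` of any irreducible `k[N]`-submodule `W ⊆ S`,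
each of which is irreducible.  Clifford 1937, Thm. 1; Curtis–Reiner (49.2).
[cite: Clifford1937, Thm. 1] [cite: CurtisReiner1962, (49.2)] -/
theorem isSemisimpleModule_resSubmodule_of_isSimpleModule
    (S : Submodule (MonoidAlgebra k G) ρ.asModule) (hS : IsSimpleModule (MonoidAlgebra k G) S) :
    IsSemisimpleModule (MonoidAlgebra k N) (resSubmodule ρ N S) := by
  classical
  set T₀ := resSubmodule ρ N S with hT₀
  -- the lattice of `k[N]`-submodules of `V` is atomic (`V` is Artinian over `k`, hence over `k[N]`)
  haveI : IsArtinian (MonoidAlgebra k N) (restrictSubgroup ρ N).asModule :=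
    isArtinian_of_tower k inferInstance
  haveI : IsAtomic (Submodule (MonoidAlgebra k N) (restrictSubgroup ρ N).asModule) :=
    isAtomic_of_orderBot_wellFounded_lt wellFounded_lt
  -- `T₀ ≠ ⊥`
  have hSatom : IsAtom S := isSimpleModule_iff_isAtom.mp hS
  have hT₀ne : T₀ ≠ ⊥ := by
    intro h
    apply hSatom.1
    rw [eq_bot_iff]
    intro y hy
    have hy' : (restrictSubgroup ρ N).asModuleEquiv.symm (ρ.asModuleEquiv y) ∈ T₀ := by
      simpa [hT₀] using hy
    rw [h, Submodule.mem_bot] at hy'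
    rw [Submodule.mem_bot]
    simpa using hy'
  -- an irreducible `k[N]`-submodule `W ⊆ S`
  obtain ⟨W, hWatom, hWle⟩ := (eq_bot_or_exists_atom_le T₀).resolve_left hT₀ne
  -- the sum of its conjugates
  set T : Submodule (MonoidAlgebra k N) (restrictSubgroup ρ N).asModule :=
    ⨆ g : G, conjSubmodule ρ N g W with hT
  -- `T ≤ T₀` (`S` is `G`-stable)
  have hconj_le : ∀ g : G, conjSubmodule ρ N g W ≤ T₀ := by
    intro g x hx
    rw [mem_conjSubmodule] at hx
    have h1 : ρ.asModuleEquiv.symm (ρ g⁻¹ ((restrictSubgroup ρ N).asModuleEquiv x)) ∈ S := by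
      have h2 := hWle hx
      simpa [hT₀] using h2
    rw [_root_.Representation.asModuleEquiv_symm_map_rho] at h1
    have h3 := S.smul_mem (MonoidAlgebra.of k G g) h1
    rw [smul_smul, ← map_mul, mul_inv_cancel, map_one, one_smul] at h3
    simpa [hT₀] using h3
  have hTle : T ≤ T₀ := iSup_le hconj_le
  -- `T` is `G`-stable: `ρ(h) T = T`
  have hTconj : ∀ h : G, conjSubmodule ρ N h T = T := by
    intro h
    rw [hT, ← conjOrderIso_apply, OrderIso.map_iSup]
    simp only [conjOrderIso_apply, conjSubmodule_mul]
    exact (Group.mulLeft_bijective h).surjective.iSup_comp fun g ↦ conjSubmodule ρ N g W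
  have hTstab : ∀ g : G, ∀ x : (restrictSubgroup ρ N).asModule, x ∈ T →
      (restrictSubgroup ρ N).asModuleEquiv.symm (ρ g ((restrictSubgroup ρ N).asModuleEquiv x)) ∈ T := by
    intro g x hx
    have h1 : x ∈ conjSubmodule ρ N g⁻¹ T := by rw [hTconj]; exact hx
    rw [mem_conjSubmodule, inv_inv] at h1
    exact h1
  -- so `T` comes from a non-zero `k[G]`-submodule of `S`, which is all of `S`
  set TG : Submodule (MonoidAlgebra k G) ρ.asModule := indSubmodule ρ N T hTstab with hTG
  have hTGle : TG ≤ S := by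
    intro y hy
    rw [hTG, mem_indSubmodule] at hy
    have h1 := hTle hy
    simpa [hT₀] using h1
  have hTGne : TG ≠ ⊥ := by
    intro h
    apply hWatom.1
    rw [eq_bot_iff]
    intro x hx
    have hxT : x ∈ T := by
      have : W ≤ T := by
        have h1 : conjSubmodule ρ N 1 W ≤ T := le_iSup (fun g ↦ conjSubmodule ρ N g W) 1
        rwa [conjSubmodule_one] at h1
      exact this hx
    have hxTG : ρ.asModuleEquiv.symm ((restrictSubgroup ρ N).asModuleEquiv x) ∈ TG := by
      rw [hTG, mem_indSubmodule]
      simpa using hxT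
    rw [h, Submodule.mem_bot] at hxTG
    rw [Submodule.mem_bot]
    simpa using hxTG
  have hTGeq : TG = S := ((hSatom.le_iff.mp hTGle).resolve_left hTGne)
  have hTeq : T = T₀ := by
    refine le_antisymm hTle fun x hx ↦ ?_
    have h1 : ρ.asModuleEquiv.symm ((restrictSubgroup ρ N).asModuleEquiv x) ∈ S := by
      simpa [hT₀] using hx
    rw [← hTGeq, hTG, mem_indSubmodule] at h1
    simpa using h1
  -- each conjugate is irreducible, so their sum `T = T₀` is semisimple
  have hsemi : IsSemisimpleModule (MonoidAlgebra k N)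
      ↥(⨆ g ∈ (Set.univ : Set G), conjSubmodule ρ N g W) := by
    refine isSemisimpleModule_biSup_of_isSemisimpleModule_submodule fun g _ ↦ ?_
    haveI : IsSimpleModule (MonoidAlgebra k N) (conjSubmodule ρ N g W) :=
      isSimpleModule_iff_isAtom.mpr (isAtom_conjSubmodule ρ N hWatom)
    infer_instance
  rw [iSup_univ, ← hT, hTeq] at hsemi
  exact hsemi

/-- **Clifford's theorem.**  Let `k` be a field, `G` a group, `N ◁ G` a normal subgroup and `ρ`
a representation of `G` on a finite-dimensional `k`-vector space `V`.  If `ρ` is semisimple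
(every subrepresentation has a complement, Mathlib `Representation.IsSemisimpleRepresentation`),
then so is its restriction `ρ|_N = restrictSubgroup ρ N = ρ.comp N.subtype` to `N`.  Proof: `V` is the sum of its
irreducible `k[G]`-submodules (Mathlib `IsSemisimpleModule.sSup_simples_eq_top`), each of which
is a semisimple `k[N]`-module (`isSemisimpleModule_resSubmodule_of_isSimpleModule`), and a module
generated by semisimple submodules is semisimple (Mathlib
`isSemisimpleModule_of_isSemisimpleModule_submodule`).
Clifford, Ann. of Math. 38 (1937), Thm. 1; Curtis–Reiner (1962), (49.2).
[cite: Clifford1937, Thm. 1] [cite: CurtisReiner1962, (49.2)] -/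
theorem isSemisimpleRepresentation_restrictSubgroup (h : ρ.IsSemisimpleRepresentation) :
    (restrictSubgroup ρ N).IsSemisimpleRepresentation := by
  classical
  rw [_root_.Representation.isSemisimpleRepresentation_iff_isSemisimpleModule_asModule] at h ⊢
  haveI := h
  refine isSemisimpleModule_of_isSemisimpleModule_submodule
    (s := {S : Submodule (MonoidAlgebra k G) ρ.asModule | IsSimpleModule (MonoidAlgebra k G) S})
    (p := resSubmodule ρ N) (fun S hS ↦ isSemisimpleModule_resSubmodule_of_isSimpleModule ρ N S hS)
    ?_
  -- the restrictions of the irreducible `k[G]`-submodules generate `V`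
  rw [eq_top_iff]
  intro x _
  have hx : ρ.asModuleEquiv.symm ((restrictSubgroup ρ N).asModuleEquiv x) ∈
      sSup {S : Submodule (MonoidAlgebra k G) ρ.asModule | IsSimpleModule (MonoidAlgebra k G) S} := by
    rw [IsSemisimpleModule.sSup_simples_eq_top]
    exact Submodule.mem_top
  rw [Submodule.mem_sSup_iff_exists_finset] at hx
  obtain ⟨s, hs, hxs⟩ := hx
  rw [Submodule.mem_iSup_finset_iff_exists_sum] at hxs
  obtain ⟨μ, hμ⟩ := hxs
  -- `x = Σ μ_S` with `μ_S ∈ S`, and `μ_S ∈ resSubmodule S`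
  have hx' : x = ∑ S ∈ s, (restrictSubgroup ρ N).asModuleEquiv.symm (ρ.asModuleEquiv (μ S : ρ.asModule)) := by
    have h1 := congrArg (fun y ↦ (restrictSubgroup ρ N).asModuleEquiv.symm (ρ.asModuleEquiv y)) hμ
    simpa [map_sum] using h1.symm
  rw [hx']
  refine Submodule.sum_mem _ fun S hS' ↦ ?_
  have hmem : (restrictSubgroup ρ N).asModuleEquiv.symm (ρ.asModuleEquiv (μ S : ρ.asModule)) ∈
      resSubmodule ρ N S := by
    rw [mem_resSubmodule]
    simp
  exact Submodule.mem_iSup_of_mem S (Submodule.mem_iSup_of_mem (hs hS') hmem)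

end Representation

end Literature.RepresentationTheory.Semisimple
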